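import Summits.HodgeConjecture.HodgeConjecture.Theorems.Q8SymplecticPowersTranscendentalPartTransport
import Mathlib.LinearAlgebra.BilinearForm.TensorProduct
import HarnessLib

/-!
# Route `Q8SymplecticPowers`, crux K1Q — (ε) BASE-POINT TRANSPORT for stub S5 `stub_monodromyBireflectionQ`

Support file for crux K1Q `VeryGeneralQuaternionCommutatorsInHg` (stmt-HodgeConjecture-24190; `--supports … --as helper`; nothing here
closes an item). Prover seat `hodge-nonav-19716-p2` (g14). Stub S5 (skeleton «mechanism-v6∕v7», l.105) asks, at EVERY member `s` of the
`Q`-family, for a monodromy element `γ ∈ Γ_s` acting on `ker((τ_s^*)² + 1) ⊗ ℂ` as an `(i, −i)`-bireflection in the local currency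
(`ℓp, ℓm`, the deck maps `A = τ_s^*`, `B = j_s^*`, the form `Qf = tr ∘ cup`). The MON-C programme assembles that clause AT A POINT from a
geometric two-ball datum near the `d6`-degeneration (`Q8MonodromyBireflectionAssembly`); this file carries the clause from ONE member `s₀` to
every member `s` along the base, exactly like the transport (δ) for S4 (`Q8SymplecticPowersTranscendentalPartTransport`).

* §1 `baseChange_scale` — the complexification of `Q₁ (T x) (T y) = d · Q₀ x y`; `transport_bireflection_clause` — the abstract transport:
  for `T : V₀ ≃ V₁` intertwining `A₀, A₁` and `B₀, B₁`, scaling `Q₀` to `Q₁` by `d ≠ 0`, and `T Γ₀ T⁻¹ ⊆ Γ₁`, the S5 `∃`-clause passes from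
  the `0`-side to the `1`-side (`γ ↦ T γ T⁻¹`, `ℓ ↦ (T ⊗ ℂ) ℓ`; the fixing clause by pull-back).
* §2 `monodromyBireflection_clause_transport` — **(ε)** in the exact `let`-currency of `stub_monodromyBireflectionQ`: under the S6 package
  binders, `∀ hU s₀ s, [S5 clause at s₀] → [S5 clause at s]`. The rational transports `T` (degree 2), `T₄` (degree 4) along a path class
  `s₀ ⇝ s` (the base is path connected) intertwine `τ^*` and `j^*` (`transport_pull_fiberOverEnd`), conjugate `Γ_{s₀}` into `Γ_s`
  (`conj_mem_ratMonodromyGroup_of_isRatTransport`) and scale `tr ∘ cup` by some `d` (`exists_tr_cup_transport_eq`); here `d ≠ 0` is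
  needed and holds: `d = 0` would make `Qf_s ≡ 0`, so `H²(X_s; ℚ) = 0` (`nondegenerate_tr_cup`), so `H²(X_{s₀}; ℚ) = 0`, contradicting
  `Qf(ℓp, B ℓm) ≠ 0` at `s₀`.

HONEST FRAMING: topological∕linear-algebraic bookkeeping; K1Q is NOT proved (S5 at one member is the MON-C programme's; S1, S4-inputs, S8
remain); nothing here bears on HC ∕ HC_AV.

## References
* [VoisinHodgeII2003] C. Voisin, *Hodge Theory and Complex Algebraic Geometry II*, CUP 2003, §3.1.2 (transport, monodromy at path-joined
  points).
* [CarlsonMullerStachPeters2017] J. Carlson, S. Müller-Stach, C. Peters, *Period Mappings and Period Domains*, 2nd ed. (2017),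
  Lemma–Definition 15.3.7.
-/

noncomputable section

set_option linter.dupNamespace false
set_option maxHeartbeats 800000

namespace Summit.HodgeConjecture.HodgeConjecture.Theorems.Q8SymplecticPowersMonodromyBireflectionTransport

open scoped TensorProduct
open Summit.HodgeConjecture.HodgeConjecture.Theorems.Q8SymplecticPowersTransportClausesAlgebra
open Summit.HodgeConjecture.HodgeConjecture.Theorems.Q8SymplecticPowersTranscendentalPartTransport
open CategoryTheory CategoryTheory.Limits AlgebraicGeometry
open Literature.AlgebraicGeometry.Motives Literature.AlgebraicGeometry.HodgeTheory
open Literature.AlgebraicGeometry.HodgeTheory.BettiUniverse Literature.AlgebraicGeometry.HodgeTheory.Q8Family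
open Literature.AlgebraicTopology.SingularHomology

/-! ### §1 Linear algebra: transport of the S5 clause along an intertwining linear equivalence -/

section Algebra

variable {V₀ V₁ : Type*} [AddCommGroup V₀] [Module ℚ V₀] [AddCommGroup V₁] [Module ℚ V₁]

/-- Complexification of a scaling identity: if `Q₁ (T x) (T y) = d · Q₀ x y` then
`(Q₁ ⊗ ℂ) ((T ⊗ ℂ) x) ((T ⊗ ℂ) y) = d · (Q₀ ⊗ ℂ) x y`. [folklore] -/
theorem baseChange_scale (T : V₀ ≃ₗ[ℚ] V₁) (Q₀ : LinearMap.BilinForm ℚ V₀) (Q₁ : LinearMap.BilinForm ℚ V₁) (d : ℚ)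
    (hQ : ∀ x y, Q₁ (T x) (T y) = d * Q₀ x y) (x y : ℂ ⊗[ℚ] V₀) :
    (Q₁.baseChange ℂ) ((T.baseChange ℚ ℂ V₀ V₁) x) ((T.baseChange ℚ ℂ V₀ V₁) y) =
      (d : ℂ) * (Q₀.baseChange ℂ) x y := by
  induction x using TensorProduct.induction_on with
  | zero => simp only [map_zero, LinearMap.zero_apply, mul_zero]
  | add a b ha hb => simp only [map_add, LinearMap.add_apply, ha, hb, mul_add]
  | tmul c v =>
    induction y using TensorProduct.induction_on with
    | zero => simp only [map_zero, mul_zero]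
    | add a b ha hb => simp only [map_add, ha, hb, mul_add]
    | tmul c' w =>
      rw [LinearEquiv.baseChange_tmul, LinearEquiv.baseChange_tmul, LinearMap.BilinForm.baseChange_tmul,
        LinearMap.BilinForm.baseChange_tmul, hQ, Algebra.smul_def, Algebra.smul_def, map_mul, eq_ratCast, eq_ratCast]
      ring

/-- **Transport of the S5 `∃`-clause of `stub_monodromyBireflectionQ` along an intertwining linear equivalence** (abstract form):
`T : V₀ ≃ V₁` intertwining `A₀, A₁` and `B₀, B₁`, scaling `Q₀` to `Q₁` by `d ≠ 0`, with `T Γ₀ T⁻¹ ⊆ Γ₁`; then the clause at the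
`0`-side (with `γ ∈ Γ₀`) gives the clause at the `1`-side (with `T γ T⁻¹ ∈ Γ₁`, `ℓp, ℓm ↦ (T ⊗ ℂ) ℓp, (T ⊗ ℂ) ℓm`). [folklore] -/
theorem transport_bireflection_clause (T : V₀ ≃ₗ[ℚ] V₁) (A₀ B₀ : V₀ →ₗ[ℚ] V₀) (A₁ B₁ : V₁ →ₗ[ℚ] V₁)
    (hA : ∀ x, T (A₀ x) = A₁ (T x)) (hB : ∀ x, T (B₀ x) = B₁ (T x))
    (Q₀ : LinearMap.BilinForm ℚ V₀) (Q₁ : LinearMap.BilinForm ℚ V₁) (d : ℚ) (hd : d ≠ 0)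
    (hQ : ∀ x y, Q₁ (T x) (T y) = d * Q₀ x y)
    (Γ₀ : Subgroup (V₀ ≃ₗ[ℚ] V₀)) (Γ₁ : Subgroup (V₁ ≃ₗ[ℚ] V₁))
    (hΓ₀ : ∀ g ∈ Γ₀, T.symm.trans (g.trans T) ∈ Γ₁) :
    (∃ γ ∈ Γ₀, ∃ ℓp ℓm : ℂ ⊗[ℚ] V₀, ℓp ∈ (Module.End.eigenspace (A₀ ^ 2) (-1)).baseChange ℂ ∧ ℓm ∈ (Module.End.eigenspace (A₀ ^ 2) (-1)).baseChange ℂ ∧ A₀.baseChange ℂ ℓp = Complex.I • ℓp ∧ A₀.baseChange ℂ ℓm = Complex.I • ℓm ∧ (Q₀.baseChange ℂ) ℓp (B₀.baseChange ℂ ℓm) ≠ 0 ∧ (γ.toLinearMap.baseChange ℂ) ℓp = Complex.I • ℓp ∧ (γ.toLinearMap.baseChange ℂ) ℓm = (-Complex.I) • ℓm ∧ ∀ x ∈ (Module.End.eigenspace (A₀ ^ 2) (-1)).baseChange ℂ, A₀.baseChange ℂ x = Complex.I • x → (Q₀.baseChange ℂ) x (B₀.baseChange ℂ ℓp) = 0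 → (Q₀.baseChange ℂ) x (B₀.baseChange ℂ ℓm) = 0 → (γ.toLinearMap.baseChange ℂ) x = x) →
    (∃ γ ∈ Γ₁, ∃ ℓp ℓm : ℂ ⊗[ℚ] V₁, ℓp ∈ (Module.End.eigenspace (A₁ ^ 2) (-1)).baseChange ℂ ∧ ℓm ∈ (Module.End.eigenspace (A₁ ^ 2) (-1)).baseChange ℂ ∧ A₁.baseChange ℂ ℓp = Complex.I • ℓp ∧ A₁.baseChange ℂ ℓm = Complex.I • ℓm ∧ (Q₁.baseChange ℂ) ℓp (B₁.baseChange ℂ ℓm) ≠ 0 ∧ (γ.toLinearMap.baseChange ℂ) ℓp = Complex.I • ℓp ∧ (γ.toLinearMap.baseChange ℂ) ℓm = (-Complex.I) • ℓm ∧ ∀ x ∈ (Module.End.eigenspace (A₁ ^ 2) (-1)).baseChange ℂ, A₁.baseChange ℂ x = Complex.I • x → (Q₁.baseChange ℂ) x (B₁.baseChange ℂ ℓp) = 0 → (Q₁.baseChange ℂ) x (B₁.baseChange ℂ ℓm) = 0 → (γ.toLinearMap.baseChange ℂ) x = x) := by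
  rintro ⟨γ, hγ, ℓp, ℓm, hp, hm, hAp, hAm, hQne, hγp, hγm, hfix⟩
  set E : ℂ ⊗[ℚ] V₀ ≃ₗ[ℂ] ℂ ⊗[ℚ] V₁ := T.baseChange ℚ ℂ V₀ V₁ with hE
  have hA2 : ∀ x, T ((A₀ ^ 2) x) = (A₁ ^ 2) (T x) := fun x => by
    simp only [pow_two, Module.End.mul_apply, hA]
  -- `E = T ⊗ ℂ` carries `ker(A₀² + 1) ⊗ ℂ` onto `ker(A₁² + 1) ⊗ ℂ`, intertwines `A, B, γ`, and scales `Q ⊗ ℂ` by `d`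
  have hEig : Submodule.map (E : ℂ ⊗[ℚ] V₀ →ₗ[ℂ] ℂ ⊗[ℚ] V₁) ((Module.End.eigenspace (A₀ ^ 2) (-1)).baseChange ℂ) =
      (Module.End.eigenspace (A₁ ^ 2) (-1)).baseChange ℂ := by
    rw [hE, baseChange_map_eq, map_eigenspace_eq T _ _ hA2]
  have hmem : ∀ z, z ∈ (Module.End.eigenspace (A₁ ^ 2) (-1)).baseChange ℂ ↔
      E.symm z ∈ (Module.End.eigenspace (A₀ ^ 2) (-1)).baseChange ℂ := fun z => by
    rw [← hEig, Submodule.mem_map_equiv]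
  have hAE : ∀ z, E (A₀.baseChange ℂ z) = A₁.baseChange ℂ (E z) := fun z => by
    rw [hE]; exact baseChange_intertwines T A₀ A₁ hA z
  have hBE : ∀ z, E (B₀.baseChange ℂ z) = B₁.baseChange ℂ (E z) := fun z => by
    rw [hE]; exact baseChange_intertwines T B₀ B₁ hB z
  have hQE : ∀ x y, (Q₁.baseChange ℂ) (E x) (E y) = (d : ℂ) * (Q₀.baseChange ℂ) x y := fun x y => by
    rw [hE]; exact baseChange_scale T Q₀ Q₁ d hQ x y
  have hγE : ∀ z, ((T.symm.trans (γ.trans T)).toLinearMap.baseChange ℂ) (E z) =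
      E ((γ.toLinearMap.baseChange ℂ) z) := fun z => by
    rw [hE]; exact baseChange_conj_apply T γ z
  have hdC : (d : ℂ) ≠ 0 := by exact_mod_cast hd
  refine ⟨T.symm.trans (γ.trans T), hΓ₀ γ hγ, E ℓp, E ℓm, ?_, ?_, ?_, ?_, ?_, ?_, ?_, ?_⟩
  · exact (hmem _).2 (by rw [LinearEquiv.symm_apply_apply]; exact hp)
  · exact (hmem _).2 (by rw [LinearEquiv.symm_apply_apply]; exact hm)
  · rw [← hAE, hAp, map_smul]
  · rw [← hAE, hAm, map_smul]
  · rw [← hBE, hQE]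
    exact mul_ne_zero hdC hQne
  · rw [hγE, hγp, map_smul]
  · rw [hγE, hγm, map_smul]
  · intro x hx hAx hQp hQm
    -- pull back to `x₀ := E⁻¹ x`
    obtain ⟨x₀, rfl⟩ : ∃ x₀, E x₀ = x := ⟨E.symm x, E.apply_symm_apply x⟩
    have hx₀ : x₀ ∈ (Module.End.eigenspace (A₀ ^ 2) (-1)).baseChange ℂ := by
      have h1 := (hmem _).1 hx
      rwa [LinearEquiv.symm_apply_apply] at h1
    have hAx₀ : A₀.baseChange ℂ x₀ = Complex.I • x₀ := by
      apply E.injective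
      rw [hAE, hAx, map_smul]
    have hQp₀ : (Q₀.baseChange ℂ) x₀ (B₀.baseChange ℂ ℓp) = 0 := by
      have h1 := hQE x₀ (B₀.baseChange ℂ ℓp)
      rw [hBE, hQp] at h1
      exact (mul_eq_zero.mp h1.symm).resolve_left hdC
    have hQm₀ : (Q₀.baseChange ℂ) x₀ (B₀.baseChange ℂ ℓm) = 0 := by
      have h1 := hQE x₀ (B₀.baseChange ℂ ℓm)
      rw [hBE, hQm] at h1
      exact (mul_eq_zero.mp h1.symm).resolve_left hdC
    rw [hγE, hfix x₀ hx₀ hAx₀ hQp₀ hQm₀]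

end Algebra

/-! ### §2 (ε): the S5 clause is transported along the base -/

/-- **(ε) BASE-POINT TRANSPORT for S5** — in the exact `let`-currency of `stub_monodromyBireflectionQ` (skeleton «mechanism-v6∕v7» l.105;
the S6 package binders `W 𝒳 π τ j ι` + clauses, `hU`): for `s₀, s ∈ W(ℂ)`, the S5 `∃`-clause at `s₀` implies the S5 `∃`-clause at
`s`. `W(ℂ)` is path connected; the rational transports `T` (degree 2), `T₄` (degree 4) along a path class `s₀ ⇝ s` intertwine `τ^*` and
`j^*` (`transport_pull_fiberOverEnd`), conjugate `Γ_{s₀}` into `Γ_s` (`conj_mem_ratMonodromyGroup_of_isRatTransport`) and scale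
`tr ∘ cup` by a `d ≠ 0` (`exists_tr_cup_transport_eq`; `d ≠ 0` from `nondegenerate_tr_cup` and `Qf(ℓp, B ℓm) ≠ 0`); conclude by
`transport_bireflection_clause`. [cite: VoisinHodgeII2003, §3.1.2] [cite: CarlsonMullerStachPeters2017, Lemma–Definition 15.3.7] -/
theorem monodromyBireflection_clause_transport :
    open Literature.AlgebraicGeometry.Motives Literature.AlgebraicGeometry.HodgeTheory Literature.AlgebraicGeometry.HodgeTheory.BettiUniverse Literature.AlgebraicGeometry.HodgeTheory.Q8Family Literature.AlgebraicGeometry.RelativeSpec Literature.AlgebraicGeometry.RelativeSpec.ActionOver CategoryTheory CategoryTheory.Limits MonoidalCategory CartesianMonoidalCategory AlgebraicGeometry in ∀ ⦃e : ℕ⦄, Even e → 4 ≤ e → ∀ (W : (Spec (.of (ParamRing e))).Opens) (𝒳 : SchemeOver ℂ) (π : 𝒳 ⟶ base W) (τ j : 𝒳 ⟶ 𝒳) (ι : (deckChart (fun i => (MvPolynomial.X i : ParamRing e)) ⊗ Over.mk W.ι).left ⟶ 𝒳.left), Nonempty (ComplexPoints (base W)) → ∀ (hπ : IsSmoothProjectiveFamily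 π 2), IsQuasiProjectiveOver 𝒳 → IsQuasiProjectiveOver (base W) → AlgebraicGeometry.SmoothOfRelativeDimension (Fintype.card (CIdx e)) (base W).hom → ∀ (hτπ : τ ≫ π = π) (hjπ : j ≫ π = π), τ ≫ τ ≫ τ ≫ τ = 𝟙 𝒳 → j ≫ j = τ ≫ τ → τ ≫ j ≫ τ = j → IsOpenImmersion ι → ι ≫ π.left = (snd (deckChart (fun i => (MvPolynomial.X i : ParamRing e))) (Over.mk W.ι)).left → ((Over.isoMk ((deckAction (fun i => (MvPolynomial.X i : ParamRing e))).aut (QuaternionGroup.a 1)) ((deckAction (fun i => (MvPolynomial.X i : ParamRing e))).aut_comp (QuaternionGroup.a 1))).hom ▷ Over.mk W.ι).left ≫ ι = ι ≫ τ.left → ((Over.isoMk ((deckAction (fun i => (MvPolynomial.X i : ParamRing e))).aut (QuaternionGroup.xa 0)) ((deckAction (fun i => (MvPolynomial.X i : ParamRing e))).aut_comp (QuaternionGroup.xa 0))).hom ▷ Over.mk W.ι).left ≫ ι = ι ≫ j.left → Function.Surjective (snd (deckChart (fun i => (MvPolynomial.X i : ParamRing e))) (Over.mk W.ι)).left → ∀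 (hU : IsCohomologicallyLocallyTrivialOn π Set.univ) (s₀ s : ComplexPoints (base W)), (let Xs := fiberOver π s₀; let hXs : IsSmoothProjective 2 Xs := hπ.isSmoothProjective s₀; let A : bettiCohomology Xs 2 →ₗ[ℚ] bettiCohomology Xs 2 := pull (fiberOverEnd π τ hτπ s₀) 2; let B : bettiCohomology Xs 2 →ₗ[ℚ] bettiCohomology Xs 2 := pull (fiberOverEnd π j hjπ s₀) 2; let Qf : LinearMap.BilinForm ℚ (bettiCohomology Xs 2) := LinearMap.compr₂ (cup Xs 2 2) (tr hXs (2 + 2)); let Γ := ratMonodromyGroup π 2 hU ⟨s₀, Set.mem_univ s₀⟩; ∃ γ ∈ Γ, ∃ ℓp ℓm : TensorProduct ℚ ℂ (bettiCohomology Xs 2), ℓp ∈ (Module.End.eigenspace (A ^ 2) (-1)).baseChange ℂ ∧ ℓm ∈ (Module.End.eigenspace (A ^ 2) (-1)).baseChange ℂ ∧ A.baseChange ℂ ℓp = Complex.I • ℓp ∧ A.baseChange ℂ ℓm = Complex.I • ℓm ∧ (Qf.baseChange ℂ) ℓp (B.baseChange ℂ ℓm) ≠ 0 ∧ (γ.toLinearMap.baseChange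 ℂ) ℓp = Complex.I • ℓp ∧ (γ.toLinearMap.baseChange ℂ) ℓm = (-Complex.I) • ℓm ∧ ∀ x ∈ (Module.End.eigenspace (A ^ 2) (-1)).baseChange ℂ, A.baseChange ℂ x = Complex.I • x → (Qf.baseChange ℂ) x (B.baseChange ℂ ℓp) = 0 → (Qf.baseChange ℂ) x (B.baseChange ℂ ℓm) = 0 → (γ.toLinearMap.baseChange ℂ) x = x) → (let Xs := fiberOver π s; let hXs : IsSmoothProjective 2 Xs := hπ.isSmoothProjective s; let A : bettiCohomology Xs 2 →ₗ[ℚ] bettiCohomology Xs 2 := pull (fiberOverEnd π τ hτπ s) 2; let B : bettiCohomology Xs 2 →ₗ[ℚ] bettiCohomology Xs 2 := pull (fiberOverEnd π j hjπ s) 2; let Qf : LinearMap.BilinForm ℚ (bettiCohomology Xs 2) := LinearMap.compr₂ (cup Xs 2 2) (tr hXs (2 + 2)); let Γ := ratMonodromyGroup π 2 hU ⟨s, Set.mem_univ s⟩; ∃ γ ∈ Γ, ∃ ℓp ℓm : TensorProduct ℚ ℂ (bettiCohomology Xs 2), ℓp ∈ (Module.End.eigenspace (A ^ 2) (-1)).baseChange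 ℂ ∧ ℓm ∈ (Module.End.eigenspace (A ^ 2) (-1)).baseChange ℂ ∧ A.baseChange ℂ ℓp = Complex.I • ℓp ∧ A.baseChange ℂ ℓm = Complex.I • ℓm ∧ (Qf.baseChange ℂ) ℓp (B.baseChange ℂ ℓm) ≠ 0 ∧ (γ.toLinearMap.baseChange ℂ) ℓp = Complex.I • ℓp ∧ (γ.toLinearMap.baseChange ℂ) ℓm = (-Complex.I) • ℓm ∧ ∀ x ∈ (Module.End.eigenspace (A ^ 2) (-1)).baseChange ℂ, A.baseChange ℂ x = Complex.I • x → (Qf.baseChange ℂ) x (B.baseChange ℂ ℓp) = 0 → (Qf.baseChange ℂ) x (B.baseChange ℂ ℓm) = 0 → (γ.toLinearMap.baseChange ℂ) x = x) := by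
  intro e he h4 W 𝒳 π τ j ι hne hπ hqp hqpW hsm hτπ hjπ hτ4 hj2 hτjτ hιo hιπ hιτ hιj hsurj hU s₀ s h0 Xs hXs A B Qf Γ
  classical
  -- ### instances: Ehresmann (rational transports exist) and path-connectedness of `W(ℂ)`
  haveI := hπ.smoothOfRelativeDimension
  haveI := hπ.isProper
  haveI : LocallyOfFiniteType (base W).hom := hqpW.locallyOfFiniteType
  haveI : IsSeparated (base W).hom := hqpW.isVarietyPair_ofScheme.isSeparated
  haveI : QuasiCompact (base W).hom := hqpW.isVarietyPair_ofScheme.quasiCompact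
  haveI : CompactSpace (base W).left := QuasiCompact.compactSpace_of_compactSpace (base W).hom
  have hrat2 : ∀ (a b : (Set.univ : Set (ComplexPoints (base W)))) (γ : Path.Homotopic.Quotient a b)
      (α : complexBetti (fiberOver π a.1) 2), IsRationalClass α → IsRationalClass (transportFun π 2 hU γ α) :=
    fun a b γ α hα => isRationalClass_transportFun_univ (f := π) (k := 2) 2 (Fintype.card (CIdx e)) γ hα
  have hrat4 : ∀ (a b : (Set.univ : Set (ComplexPoints (base W)))) (γ : Path.Homotopic.Quotient a b)
      (α : complexBetti (fiberOver π a.1) (2 + 2)), IsRationalClass α →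
        IsRationalClass (transportFun π (2 + 2) hU γ α) :=
    fun a b γ α hα => isRationalClass_transportFun_univ (f := π) (k := 2 + 2) 2 (Fintype.card (CIdx e)) γ hα
  have hirr : IrreducibleSpace (base W).left := by
    obtain ⟨t₀⟩ := hne
    haveI : IrreducibleSpace (Spec (CommRingCat.of (ParamRing e))) :=
      inferInstanceAs (IrreducibleSpace (PrimeSpectrum (ParamRing e)))
    change IrreducibleSpace W
    exact isIrreducible_iff_irreducibleSpace.mp ⟨⟨W.ι t₀.pt, by rw [← Scheme.Opens.range_ι]; exact ⟨t₀.pt, rfl⟩⟩,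
      (PreirreducibleSpace.isPreirreducible_univ (X := Spec (CommRingCat.of (ParamRing e)))).open_subset W.isOpen
        (Set.subset_univ _)⟩
  haveI : ConnectedSpace (ComplexPoints (base W)) := connectedSpace_complexPoints_of_irreducibleSpace _
  haveI : PathConnectedSpace (ComplexPoints (base W)) :=
    pathConnectedSpace_complexPoints_of_smoothOfRelativeDimension _ (Fintype.card (CIdx e))
  haveI : PathConnectedSpace (Set.univ : Set (ComplexPoints (base W))) :=
    isPathConnected_iff_pathConnectedSpace.mp isPathConnected_univ
  -- ### a path class `δ : s₀ ⇝ s` and the rational transports along it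
  let δ : Path.Homotopic.Quotient (⟨s₀, Set.mem_univ s₀⟩ : (Set.univ : Set (ComplexPoints (base W))))
      ⟨s, Set.mem_univ s⟩ := Path.Homotopic.Quotient.mk (PathConnectedSpace.somePath _ _)
  obtain ⟨T, hT⟩ : ∃ T : bettiCohomology (fiberOver π s₀) 2 ≃ₗ[ℚ] bettiCohomology (fiberOver π s) 2,
      IsRatTransport π 2 hU δ T := exists_ratTransport π 2 hU hrat2 δ
  obtain ⟨T₄, hT₄⟩ : ∃ T₄ : bettiCohomology (fiberOver π s₀) (2 + 2) ≃ₗ[ℚ] bettiCohomology (fiberOver π s) (2 + 2),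
      IsRatTransport π (2 + 2) hU δ T₄ := exists_ratTransport π (2 + 2) hU hrat4 δ
  -- ### the ingredients of `transport_bireflection_clause`
  have hA : ∀ x, T (pull (fiberOverEnd π τ hτπ s₀) 2 x) = A (T x) := fun x =>
    transport_pull_fiberOverEnd π 2 hU τ hτπ hT x
  have hB : ∀ x, T (pull (fiberOverEnd π j hjπ s₀) 2 x) = B (T x) := fun x =>
    transport_pull_fiberOverEnd π 2 hU j hjπ hT x
  have hΓ₀ : ∀ g ∈ ratMonodromyGroup π 2 hU ⟨s₀, Set.mem_univ s₀⟩, T.symm.trans (g.trans T) ∈ Γ := fun g hg =>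
    conj_mem_ratMonodromyGroup_of_isRatTransport π 2 hU hT hg
  obtain ⟨d, hd⟩ := exists_tr_cup_transport_eq π hπ hU hT hT₄
  have hQ : ∀ x y, Qf (T x) (T y) =
      d * LinearMap.compr₂ (cup (fiberOver π s₀) 2 2) (tr (hπ.isSmoothProjective s₀) (2 + 2)) x y := fun x y =>
    (LinearMap.compr₂_apply _ _ _ _).trans ((hd x y).trans (by rw [LinearMap.compr₂_apply]))
  obtain ⟨γ, hγ, ℓp, ℓm, hp, hm, hAp, hAm, hQne, hγp, hγm, hfix⟩ := h0
  -- ### `d ≠ 0`: otherwise `Qf_s ≡ 0`, so `H²(X_s; ℚ) = 0`, so `H²(X_{s₀}; ℚ) = 0`, contradicting `Qf(ℓp, B ℓm) ≠ 0`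
  have hd0 : d ≠ 0 := by
    intro hd0
    have hQ0 : ∀ u v : bettiCohomology (fiberOver π s) 2, Qf u v = 0 := fun u v => by
      have h1 := hQ (T.symm u) (T.symm v)
      rw [LinearEquiv.apply_symm_apply, LinearEquiv.apply_symm_apply, hd0, zero_mul] at h1
      exact h1
    have hzero : ∀ u : bettiCohomology (fiberOver π s) 2, u = 0 := fun u =>
      (nondegenerate_tr_cup (hπ.isSmoothProjective s)).1 u (fun v => hQ0 u v)
    have hzero₀ : ∀ u : bettiCohomology (fiberOver π s₀) 2, u = 0 := fun u =>
      T.injective (by rw [hzero (T u), hzero (T 0)])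
    have hz : ∀ z : ℂ ⊗[ℚ] bettiCohomology (fiberOver π s₀) 2, z = 0 := fun z => by
      induction z using TensorProduct.induction_on with
      | zero => rfl
      | tmul c v => rw [hzero₀ v, TensorProduct.tmul_zero]
      | add a b ha hb => rw [ha, hb, add_zero]
    exact hQne (by rw [hz ℓp, map_zero, LinearMap.zero_apply])
  exact transport_bireflection_clause T _ _ A B hA hB _ Qf d hd0 hQ _ Γ hΓ₀
    ⟨γ, hγ, ℓp, ℓm, hp, hm, hAp, hAm, hQne, hγp, hγm, hfix⟩

end Summit.HodgeConjecture.HodgeConjecture.Theorems.Q8SymplecticPowersMonodromyBireflectionTransport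

end
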